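import Summits.Ventures.YMGap.Thresholds.CouplingContDiff
import Summits.Ventures.YMGap.Thresholds.StarInfiniteVolume
import Summits.QuantumFields.YangMills.Theorems.ContractibleFibreFibreToTorusEnergyUniqueDensity
import Literature.MathematicalPhysics.QuantumFieldTheory.Balaban1983to89.InfiniteVolumeSufficientIV
import HarnessLib

/-!
# The infinite-volume free energy density is differentiable at EVERY coupling of the strong-coupling window,
# with derivative minus the energy density of the unique DLR state (row type C-PRESS, part 1: `C¹` and `C^{1,1}`)

Cell `pub-ymgap`, seat ds-1 (gen 9). HONEST FRAMING: strong-coupling LATTICE statements for the Wilson action of a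
compact gauge group on `ℤ^d` (rows: `SU(2)`, `d = 4`); `C¹` / `C^{1,1}` regularity of the thermodynamic potential in the
coupling — NOT analyticity; the window is where the one-sided vertex-star Dobrushin bound closes, not a transition;
nothing about the continuum or the Clay problem. Kernel theorems only, 0 compute.

Object: the tree's free energy density per site `f(β) = freeEnergyDensity d ρ β = lim_L L^{-d} log Z_{Λ_L}(β)` (exists at
every `β`, `exists_hasFreeEnergyDensity_holds`; convex, `convexOn_freeEnergyDensity`). The tree had `f'` only under a
differentiability HYPOTHESIS (module III S13 `tendsto_wilsonActionDensity_of_differentiableAt`,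
`FibreToTorus.energy_deriv_freeEnergyDensity_eq`; convexity gives it off a countable set) or for `|β| < r_ρ = (264196 e² M_ρ)⁻¹`
(module XIII `differentiableAt_freeEnergyDensity_of_abs_lt`, holomorphic cluster radius, `≈ 10⁻⁷` for `SU(2)`).

1. **Squeeze (folklore real analysis).** Supporting lines `g y + s y (z - y) ≤ g z` at every `y ∈ S` give
   `0 ≤ g y - g x - s x (y - x) ≤ (s y - s x)(y - x)` (`chord_squeeze`, `abs_taylor_le_of_chord`), hence
   `HasDerivWithinAt g (s x) S x` when `s` is continuous within `S` at `x` (`hasDerivWithinAt_of_chord`). No convexity,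
   no Griffiths lemma, no finite-volume derivative.
2. **Lattice Yang–Mills, any compact metrisable `G`, continuous `ρ`, any `d`.** The supporting lines are the tree's
   energy-subgradient chords `FibreToTorus.energy_pressure_chord` (`f(β) - (β' - β) e(μ) ≤ f(β')` for translation-invariant
   `μ ∈ 𝒢(β)`, `e(μ) = Σ_{i<j} (N - ⟨Re tr ρ(U_{p_ij})⟩_μ)`; Friedli–Velenik Prop. 6.91): continuity of the plane plaquette
   expectations along a translation-invariant DLR selection gives `HasDerivWithinAt f (-e(μ_{β₀})) S β₀`
   (`hasDerivWithinAt_freeEnergyDensity`) and the exact Taylor squeeze `abs_freeEnergyDensity_taylor_le`; in a uniqueness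
   regime the state is translation invariant (`isZdTranslationInvariant_of_subsingleton`, via module IV).
3. ★ **`SU(2)`, `d = 4`, tree coupling `β ∈ [0, 9/50]` (Wilson `β_W = 2β ≤ 9/25`)**, along ANY DLR selection (unique state,
   `DSWindowZd.su2_hasUniqueGibbsMeasure_le_9_25`; C-LIP-STAR `CouplingResponse.su2_continuousOn_integral`):
   `HasDerivWithinAt f (-Σ_{i<j} (2 - ⟨Re tr U_{p_ij}⟩_{μ β})) [0, 9/50] β` at every `β ∈ [0, 9/50]` incl. `β = 0⁺`
   (`su2_hasDerivWithinAt_freeEnergyDensity`), `HasDerivAt` on `(0, 9/50)` (`su2_hasDerivAt_freeEnergyDensity`), the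
   identity `f'(β) = -e(μ)` for EVERY `μ ∈ 𝒢(β)` (`su2_deriv_freeEnergyDensity_eq`), `f ∈ C¹` (`su2_continuousOn_energyDensity`,
   `su2_contDiffOn_one_freeEnergyDensity`) and `f ∈ C^{1,1}[0, 9/50]` (`su2_freeEnergyDensity_taylor_le`).
Part 2 (`PressureSecondDerivative.lean`): `f'' =` plaquette susceptibility via C-DIFF, `f ∈ C²` on the open window.

References (mechanism): S. Friedli, Y. Velenik, *Statistical Mechanics of Lattice Systems* (CUP 2017), Prop. 6.91,
Thm. B.12; R. B. Israel, *Convexity in the Theory of Lattice Gases* (1979), §II.1 (tangent functionals).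
-/


noncomputable section

open MeasureTheory ProbabilityTheory Set Filter Topology
open scoped NNReal
open Literature.MathematicalPhysics.QuantumLattice (LGConfig ZdEdge ZdPlaquette fundamentalRep ymGibbsMeasures
  ymSpecification plaquetteObs plaquetteEdges freeEnergyDensity IsZdTranslationInvariant
  infiniteVolumeLimitPoints_nonempty_holds mem_ymGibbsMeasuresTI_of_mem_infiniteVolumeLimitPoints
  continuous_fundamentalRep)
open Literature.MathematicalPhysics.QuantumFieldTheory hiding ZdEdge
open Summit.QuantumFields.YangMills.Theorems.FibreToTorus (energy_pressure_chord)

namespace Summit.Ventures.YMGap.PressureRegularity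

/-! ## 1. The squeeze: supporting lines with a continuous slope give the derivative -/

section Squeeze

variable {g s : ℝ → ℝ} {x y : ℝ}

/-- **Two-sided chord squeeze.** If `g` has a supporting line of slope `s x` at `x` and of slope `s y` at `y`, the
first-order Taylor remainder at `x` evaluated at `y` lies between `0` and `(s y - s x)(y - x)`. [folklore] -/
theorem chord_squeeze (hx : ∀ z, g x + s x * (z - x) ≤ g z) (hy : ∀ z, g y + s y * (z - y) ≤ g z) :
    0 ≤ g y - g x - s x * (y - x) ∧ g y - g x - s x * (y - x) ≤ (s y - s x) * (y - x) := by
  constructor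
  · have h := hx y
    linarith
  · have h := hy x
    linarith

/-- **Quantitative form**: `|g y - g x - s x (y - x)| ≤ |s y - s x| · |y - x|` — a modulus of continuity of the slope
selection is a `C^{1,·}` modulus of `g`. [folklore] -/
theorem abs_taylor_le_of_chord (hx : ∀ z, g x + s x * (z - x) ≤ g z) (hy : ∀ z, g y + s y * (z - y) ≤ g z) :
    |g y - g x - s x * (y - x)| ≤ |s y - s x| * |y - x| := by
  obtain ⟨h0, h1⟩ := chord_squeeze hx hy
  rw [abs_of_nonneg h0, ← abs_mul]
  exact h1.trans (le_abs_self _)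

/-- **Supporting lines with a slope continuous within `S` at `x ∈ S` give the derivative within `S`.** [folklore] -/
theorem hasDerivWithinAt_of_chord {S : Set ℝ} (hxS : x ∈ S) (hchord : ∀ y ∈ S, ∀ z, g y + s y * (z - y) ≤ g z)
    (hs : ContinuousWithinAt s S x) : HasDerivWithinAt g (s x) S x := by
  rw [hasDerivWithinAt_iff_isLittleO, Asymptotics.isLittleO_iff]
  intro c hc
  have h1 : ∀ᶠ y in 𝓝[S] x, dist (s y) (s x) < c := Metric.tendsto_nhds.1 hs c hc
  filter_upwards [h1, eventually_mem_nhdsWithin] with y hy hyS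
  rw [Real.dist_eq] at hy
  have hrew : g y - g x - (y - x) • s x = g y - g x - s x * (y - x) := by
    rw [smul_eq_mul]; ring
  rw [hrew, Real.norm_eq_abs, Real.norm_eq_abs]
  exact (abs_taylor_le_of_chord (hchord x hxS) (hchord y hyS)).trans
    (mul_le_mul_of_nonneg_right hy.le (abs_nonneg _))

/-- **Supporting lines on a neighbourhood with a slope continuous at `x` give the derivative.** [folklore] -/
theorem hasDerivAt_of_chord {S : Set ℝ} (hS : S ∈ 𝓝 x) (hchord : ∀ y ∈ S, ∀ z, g y + s y * (z - y) ≤ g z)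
    (hs : ContinuousAt s x) : HasDerivAt g (s x) x :=
  (hasDerivWithinAt_of_chord (mem_of_mem_nhds hS) hchord hs.continuousWithinAt).hasDerivAt hS

end Squeeze

/-! ## 2. Lattice Yang–Mills: the pressure is differentiable wherever the energy density of a translation-invariant
DLR selection is continuous -/

section Lattice

variable {d N : ℕ} {G : Type} [Group G] [TopologicalSpace G] [IsTopologicalGroup G] [CompactSpace G]
  [MeasurableSpace G] [BorelSpace G] [SecondCountableTopology G] [T2Space G]

/-- Local shorthand: the planes `{(i, j) : i < j}`. -/
local notation3 (prettyPrint := false) "𝔓" d => {q : Fin d × Fin d // q.1 < q.2}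

/-- **In a uniqueness regime the unique DLR state is translation invariant**: the torus limit points are
translation-invariant DLR states (module IV `mem_ymGibbsMeasuresTI_of_mem_infiniteVolumeLimitPoints`, and they exist,
`infiniteVolumeLimitPoints_nonempty_holds`), and there is only one DLR state. [folklore] -/
theorem isZdTranslationInvariant_of_subsingleton (ρ : G →* Matrix (Fin N) (Fin N) ℂ) (hρ : Continuous ρ) {β : ℝ}
    (hsub : (ymGibbsMeasures (d := d) ρ β).Subsingleton) {μ : Measure (LGConfig d G)}
    (hμ : μ ∈ ymGibbsMeasures (d := d) ρ β) : IsZdTranslationInvariant μ := by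
  obtain ⟨ν, hν⟩ := infiniteVolumeLimitPoints_nonempty_holds (d := d) ρ hρ β
  have hνTI := mem_ymGibbsMeasuresTI_of_mem_infiniteVolumeLimitPoints ρ hρ hν
  rw [hsub hμ hνTI.1]
  exact hνTI.2

/-- **The pressure is differentiable (within `S`) wherever the energy density of a translation-invariant DLR selection is
continuous (within `S`)**, with derivative minus that energy density: for a selection `β ↦ μ β ∈ 𝒢_θ(β)` on `S` and
`β₀ ∈ S` at which every plane plaquette expectation `β ↦ ⟨Re tr ρ(U_{p_ij})⟩_{μ β}` is continuous within `S`,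
`HasDerivWithinAt f (-Σ_{i<j} (N - ⟨Re tr ρ(U_{p_ij})⟩_{μ β₀})) S β₀`. The supporting lines are the tree's energy-subgradient
chords `energy_pressure_chord`; the rest is `hasDerivWithinAt_of_chord`. [folklore] -/
theorem hasDerivWithinAt_freeEnergyDensity (ρ : G →* Matrix (Fin N) (Fin N) ℂ) (hρ : Continuous ρ) {S : Set ℝ}
    {μ : ℝ → Measure (LGConfig d G)} (hμ : ∀ β ∈ S, μ β ∈ ymGibbsMeasures (d := d) ρ β)
    (hT : ∀ β ∈ S, IsZdTranslationInvariant (μ β)) {β₀ : ℝ} (hβ₀ : β₀ ∈ S)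
    (hcont : ∀ q : 𝔓 d,
      ContinuousWithinAt (fun β => ∫ U, plaquetteObs ρ 0 q.1.1 q.1.2 U ∂(μ β)) S β₀) :
    HasDerivWithinAt (freeEnergyDensity d ρ)
      (-∑ q : 𝔓 d, ((N : ℝ) - ∫ U, plaquetteObs ρ 0 q.1.1 q.1.2 U ∂(μ β₀))) S β₀ := by
  refine hasDerivWithinAt_of_chord
    (s := fun β => -∑ q : 𝔓 d, ((N : ℝ) - ∫ U, plaquetteObs ρ 0 q.1.1 q.1.2 U ∂(μ β))) hβ₀
    (fun β hβ z => ?_) ?_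
  · have h := energy_pressure_chord ρ hρ z (hμ β hβ) (hT β hβ)
    linarith
  · have h : Tendsto (fun β => ∑ q : 𝔓 d, ((N : ℝ) - ∫ U, plaquetteObs ρ 0 q.1.1 q.1.2 U ∂(μ β)))
        (𝓝[S] β₀) (𝓝 (∑ q : 𝔓 d, ((N : ℝ) - ∫ U, plaquetteObs ρ 0 q.1.1 q.1.2 U ∂(μ β₀)))) :=
      tendsto_finsetSum _ fun q _ => tendsto_const_nhds.sub (hcont q)
    exact h.neg

/-- **Interior form**: a translation-invariant DLR selection on a neighbourhood `S` of `β₀` whose plane plaquette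
expectations are continuous at `β₀` gives `HasDerivAt f (-e(μ β₀)) β₀`. [folklore] -/
theorem hasDerivAt_freeEnergyDensity (ρ : G →* Matrix (Fin N) (Fin N) ℂ) (hρ : Continuous ρ) {S : Set ℝ}
    {μ : ℝ → Measure (LGConfig d G)} (hμ : ∀ β ∈ S, μ β ∈ ymGibbsMeasures (d := d) ρ β)
    (hT : ∀ β ∈ S, IsZdTranslationInvariant (μ β)) {β₀ : ℝ} (hS : S ∈ 𝓝 β₀)
    (hcont : ∀ q : 𝔓 d, ContinuousAt (fun β => ∫ U, plaquetteObs ρ 0 q.1.1 q.1.2 U ∂(μ β)) β₀) :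
    HasDerivAt (freeEnergyDensity d ρ)
      (-∑ q : 𝔓 d, ((N : ℝ) - ∫ U, plaquetteObs ρ 0 q.1.1 q.1.2 U ∂(μ β₀))) β₀ :=
  (hasDerivWithinAt_freeEnergyDensity ρ hρ hμ hT (mem_of_mem_nhds hS)
    fun q => (hcont q).continuousWithinAt).hasDerivAt hS

/-- **Exact Taylor squeeze for the pressure**: for two couplings carrying translation-invariant DLR states `μ`, `μ'`,
`|f(β') - f(β) + (β' - β) e(μ)| ≤ |e(μ') - e(μ)| · |β' - β|` — any modulus of continuity of the energy density in the
coupling is a `C^{1,·}` modulus of the pressure. [folklore] -/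
theorem abs_freeEnergyDensity_taylor_le (ρ : G →* Matrix (Fin N) (Fin N) ℂ) (hρ : Continuous ρ) {β β' : ℝ}
    {μ μ' : Measure (LGConfig d G)} (hμ : μ ∈ ymGibbsMeasures (d := d) ρ β) (hT : IsZdTranslationInvariant μ)
    (hμ' : μ' ∈ ymGibbsMeasures (d := d) ρ β') (hT' : IsZdTranslationInvariant μ') :
    |freeEnergyDensity d ρ β' - freeEnergyDensity d ρ β -
        (-∑ q : 𝔓 d, ((N : ℝ) - ∫ U, plaquetteObs ρ 0 q.1.1 q.1.2 U ∂μ)) * (β' - β)| ≤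
      |(-∑ q : 𝔓 d, ((N : ℝ) - ∫ U, plaquetteObs ρ 0 q.1.1 q.1.2 U ∂μ')) -
          (-∑ q : 𝔓 d, ((N : ℝ) - ∫ U, plaquetteObs ρ 0 q.1.1 q.1.2 U ∂μ))| * |β' - β| := by
  set e : ℝ := ∑ q : 𝔓 d, ((N : ℝ) - ∫ U, plaquetteObs ρ 0 q.1.1 q.1.2 U ∂μ) with he
  set e' : ℝ := ∑ q : 𝔓 d, ((N : ℝ) - ∫ U, plaquetteObs ρ 0 q.1.1 q.1.2 U ∂μ') with he'
  have h1 := energy_pressure_chord ρ hρ β' hμ hT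
  have h2 := energy_pressure_chord ρ hρ β hμ' hT'
  rw [← he] at h1
  rw [← he'] at h2
  have hR0 : 0 ≤ freeEnergyDensity d ρ β' - freeEnergyDensity d ρ β - (-e) * (β' - β) := by linarith
  have hR1 : freeEnergyDensity d ρ β' - freeEnergyDensity d ρ β - (-e) * (β' - β) ≤ (β' - β) * (e - e') := by
    linarith
  rw [abs_of_nonneg hR0]
  calc freeEnergyDensity d ρ β' - freeEnergyDensity d ρ β - (-e) * (β' - β)
      ≤ (β' - β) * (e - e') := hR1
    _ ≤ |(β' - β) * (e - e')| := le_abs_self _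
    _ = |(-e') - (-e)| * |β' - β| := by rw [abs_mul, neg_sub_neg, mul_comm]

end Lattice

/-! ## 3. `SU(2)`, `d = 4`: the pressure is `C¹` on `[0, 9/50]` (tree coupling; Wilson `β_W = 2β ≤ 9/25`) -/

section SU2

open Summit.Ventures.YMGap.CouplingResponse (su2_continuousOn_integral)
open Summit.Ventures.YMGap.DSWindowZd (su2_hasUniqueGibbsMeasure_le_9_25)

/-- Local shorthand: the planes `{(i, j) : i < j}` of `ℤ⁴`. -/
local notation3 (prettyPrint := false) "𝔓₄" => {q : Fin 4 × Fin 4 // q.1 < q.2}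

/-- `SU(2)` is second countable (closed subgroup of `2 × 2` complex matrices). [folklore] -/
private theorem secondCountable_su2 : SecondCountableTopology (Matrix.specialUnitaryGroup (Fin 2) ℂ) :=
  haveI : SecondCountableTopology (Matrix (Fin 2) (Fin 2) ℂ) :=
    inferInstanceAs (SecondCountableTopology (Fin 2 → Fin 2 → ℂ))
  Topology.IsEmbedding.subtypeVal.secondCountableTopology

/-- On the tree window `0 ≤ β ≤ 9/50` (`β_W = 2β ≤ 9/25`) the `SU(2)` DLR state is unique
(`su2_hasUniqueGibbsMeasure_le_9_25`, rescaled to the tree coupling). -/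
theorem su2_subsingleton_ymGibbsMeasures {β : ℝ} (hβ : β ∈ Icc (0 : ℝ) (9 / 50)) :
    (ymGibbsMeasures (d := 4) (fundamentalRep (Fin 2)) β).Subsingleton := by
  have h := su2_hasUniqueGibbsMeasure_le_9_25 (βW := 2 * β) (by linarith [hβ.1]) (by linarith [hβ.2])
  have e : ((2 : ℕ) : ℝ) * (2 * β / 4) = β := by push_cast; ring
  rw [e] at h
  exact h.1

/-- On the tree window every DLR state of `SU(2)` is translation invariant. -/
theorem su2_isZdTranslationInvariant {β : ℝ} (hβ : β ∈ Icc (0 : ℝ) (9 / 50))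
    {μ : Measure (LGConfig 4 (Matrix.specialUnitaryGroup (Fin 2) ℂ))}
    (hμ : μ ∈ ymGibbsMeasures (d := 4) (fundamentalRep (Fin 2)) β) : IsZdTranslationInvariant μ :=
  haveI := secondCountable_su2
  isZdTranslationInvariant_of_subsingleton _ (continuous_fundamentalRep _) (su2_subsingleton_ymGibbsMeasures hβ) hμ

/-- **C-LIP on the tree window, plane plaquettes**: along any DLR selection on `[0, 9/50]`,
`β ↦ ⟨Re tr U_{p}⟩_{μ β}` is continuous on `[0, 9/50]` (g8's `su2_continuousOn_integral` at `β_W = 2β`). -/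
theorem su2_continuousOn_plaquette {μ : ℝ → Measure (LGConfig 4 (Matrix.specialUnitaryGroup (Fin 2) ℂ))}
    (hμ : ∀ β ∈ Icc (0 : ℝ) (9 / 50), μ β ∈ ymGibbsMeasures (d := 4) (fundamentalRep (Fin 2)) β)
    (p : ZdPlaquette 4) :
    ContinuousOn (fun β => ∫ U, plaquetteObs (fundamentalRep (Fin 2)) p.1 p.2.1.1 p.2.1.2 U ∂(μ β))
      (Icc (0 : ℝ) (9 / 50)) := by
  -- the `β_W`-indexed selection `β_W ↦ μ (2 (β_W / 4))`
  have hμW : ∀ βW ∈ Icc (0 : ℝ) (9 / 25),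
      μ (2 * (βW / 4)) ∈ ymGibbsMeasures (d := 4) (fundamentalRep (Fin 2)) (2 * (βW / 4)) :=
    fun βW hβW => hμ _ ⟨by linarith [hβW.1], by linarith [hβW.2]⟩
  have hW := su2_continuousOn_integral le_rfl hμW (isLipschitzCylinder_zdPlaquetteObs (N := 2) p.1 p.2.2)
    (x₀ := p.1) (D := 1) (fun e he => by simpa using norm_fst_sub_le_of_mem_plaquetteEdges he)
  have hcomp : ContinuousOn
      ((fun βW => ∫ U, zdPlaquetteObs (fundamentalRep (Fin 2)) p.1 p.2.1.1 p.2.1.2 U ∂(μ (2 * (βW / 4)))) ∘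
        fun β : ℝ => 2 * β) (Icc (0 : ℝ) (9 / 50)) :=
    hW.comp (continuous_const.mul continuous_id).continuousOn
      fun β hβ => ⟨by linarith [hβ.1], by linarith [hβ.2]⟩
  refine ((continuousOn_const (c := (2 : ℝ))).mul hcomp).congr fun β _ => ?_
  show _ = 2 * ∫ U, zdPlaquetteObs (fundamentalRep (Fin 2)) p.1 p.2.1.1 p.2.1.2 U ∂(μ (2 * (2 * β / 4)))
  rw [show (2 : ℝ) * (2 * β / 4) = β by ring, ← integral_const_mul]
  refine integral_congr_ae (ae_of_all _ fun U => ?_)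
  rw [CouplingResponse.plaquetteObs_fundamentalRep_eq_mul_zdPlaquetteObs]
  norm_num

/-- ★ **`SU(2)`, `d = 4`: the free energy density is differentiable at EVERY coupling of the closed window `[0, 9/50]`
(one-sided at the endpoints), with derivative minus the energy density of the unique DLR state**:
`HasDerivWithinAt f (-Σ_{i<j} (2 - ⟨Re tr U_{p_ij}⟩_{μ β})) [0, 9/50] β`, along ANY DLR selection `μ` on `[0, 9/50]`. -/
theorem su2_hasDerivWithinAt_freeEnergyDensity
    {μ : ℝ → Measure (LGConfig 4 (Matrix.specialUnitaryGroup (Fin 2) ℂ))}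
    (hμ : ∀ β ∈ Icc (0 : ℝ) (9 / 50), μ β ∈ ymGibbsMeasures (d := 4) (fundamentalRep (Fin 2)) β)
    {β : ℝ} (hβ : β ∈ Icc (0 : ℝ) (9 / 50)) :
    HasDerivWithinAt (freeEnergyDensity 4 (fundamentalRep (Fin 2)))
      (-∑ q : 𝔓₄, ((2 : ℝ) - ∫ U, plaquetteObs (fundamentalRep (Fin 2)) 0 q.1.1 q.1.2 U ∂(μ β)))
      (Icc (0 : ℝ) (9 / 50)) β := by
  haveI := secondCountable_su2
  have h := hasDerivWithinAt_freeEnergyDensity (d := 4) (fundamentalRep (Fin 2)) (continuous_fundamentalRep _) hμ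
    (fun b hb => su2_isZdTranslationInvariant hb (hμ b hb)) hβ
    fun q => su2_continuousOn_plaquette hμ ((0 : Literature.Probability.LatticeModels.Site 4), q) β hβ
  simpa using h

/-- ★ **`SU(2)`, `d = 4`, open window: `HasDerivAt f (-e(μ_β)) β` at every `0 < β < 9/50`** along any DLR selection. -/
theorem su2_hasDerivAt_freeEnergyDensity
    {μ : ℝ → Measure (LGConfig 4 (Matrix.specialUnitaryGroup (Fin 2) ℂ))}
    (hμ : ∀ β ∈ Icc (0 : ℝ) (9 / 50), μ β ∈ ymGibbsMeasures (d := 4) (fundamentalRep (Fin 2)) β)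
    {β : ℝ} (hβ : β ∈ Ioo (0 : ℝ) (9 / 50)) :
    HasDerivAt (freeEnergyDensity 4 (fundamentalRep (Fin 2)))
      (-∑ q : 𝔓₄, ((2 : ℝ) - ∫ U, plaquetteObs (fundamentalRep (Fin 2)) 0 q.1.1 q.1.2 U ∂(μ β))) β :=
  (su2_hasDerivWithinAt_freeEnergyDensity hμ (Ioo_subset_Icc_self hβ)).hasDerivAt (Icc_mem_nhds hβ.1 hβ.2)

/-- **The thermodynamic identity at EVERY coupling of the open window**: `f'(β) = -Σ_{i<j} (2 - ⟨Re tr U_{p_ij}⟩_{μ})` for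
every DLR state `μ ∈ 𝒢(β)`, `0 < β < 9/50` (no differentiability hypothesis, unlike `energy_deriv_freeEnergyDensity_eq`). -/
theorem su2_deriv_freeEnergyDensity_eq {β : ℝ} (hβ : β ∈ Ioo (0 : ℝ) (9 / 50))
    {ν : Measure (LGConfig 4 (Matrix.specialUnitaryGroup (Fin 2) ℂ))}
    (hν : ν ∈ ymGibbsMeasures (d := 4) (fundamentalRep (Fin 2)) β) :
    deriv (freeEnergyDensity 4 (fundamentalRep (Fin 2))) β =
      -∑ q : 𝔓₄, ((2 : ℝ) - ∫ U, plaquetteObs (fundamentalRep (Fin 2)) 0 q.1.1 q.1.2 U ∂ν) := by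
  classical
  obtain ⟨μ, hμ⟩ := CouplingResponse.exists_dlrSelection
  -- splice `ν` into the selection at `β`
  set μ' : ℝ → Measure (LGConfig 4 (Matrix.specialUnitaryGroup (Fin 2) ℂ)) :=
    fun t => if t = β then ν else μ (2 * t) with hμ'
  have hμ'sel : ∀ t ∈ Icc (0 : ℝ) (9 / 50), μ' t ∈ ymGibbsMeasures (d := 4) (fundamentalRep (Fin 2)) t := by
    intro t _
    by_cases ht : t = β
    · simp only [hμ', ht, if_true]; exact hν
    · simp only [hμ', ht, if_false]
      have h := hμ (2 * t)
      rwa [show (2 : ℝ) * (2 * t / 4) = t by ring] at h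
  have h := (su2_hasDerivAt_freeEnergyDensity hμ'sel hβ).deriv
  simpa [hμ'] using h

/-- **`f ∈ C¹[0, 9/50]`**: the derivative `β ↦ -e(μ_β)` is continuous on the closed window (C-LIP-STAR). -/
theorem su2_continuousOn_energyDensity
    {μ : ℝ → Measure (LGConfig 4 (Matrix.specialUnitaryGroup (Fin 2) ℂ))}
    (hμ : ∀ β ∈ Icc (0 : ℝ) (9 / 50), μ β ∈ ymGibbsMeasures (d := 4) (fundamentalRep (Fin 2)) β) :
    ContinuousOn (fun β => -∑ q : 𝔓₄, ((2 : ℝ) - ∫ U, plaquetteObs (fundamentalRep (Fin 2)) 0 q.1.1 q.1.2 U ∂(μ β)))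
      (Icc (0 : ℝ) (9 / 50)) :=
  (continuousOn_finsetSum _ fun q _ => continuousOn_const.sub
    (su2_continuousOn_plaquette hμ ((0 : Literature.Probability.LatticeModels.Site 4), q))).neg

/-- `f` is differentiable on the open window. -/
theorem su2_differentiableOn_freeEnergyDensity :
    DifferentiableOn ℝ (freeEnergyDensity 4 (fundamentalRep (Fin 2))) (Ioo (0 : ℝ) (9 / 50)) := by
  obtain ⟨μ, hμ⟩ := CouplingResponse.exists_dlrSelection
  have hμsel : ∀ t ∈ Icc (0 : ℝ) (9 / 50), μ (2 * t) ∈ ymGibbsMeasures (d := 4) (fundamentalRep (Fin 2)) t := by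
    intro t _
    have h := hμ (2 * t)
    rwa [show (2 : ℝ) * (2 * t / 4) = t by ring] at h
  exact fun β hβ => (su2_hasDerivAt_freeEnergyDensity hμsel hβ).differentiableAt.differentiableWithinAt

/-- `f ∈ C¹` on the open window (`ContDiffOn ℝ 1`). -/
theorem su2_contDiffOn_one_freeEnergyDensity :
    ContDiffOn ℝ 1 (freeEnergyDensity 4 (fundamentalRep (Fin 2))) (Ioo (0 : ℝ) (9 / 50)) := by
  obtain ⟨μ, hμ⟩ := CouplingResponse.exists_dlrSelection
  have hμsel : ∀ t ∈ Icc (0 : ℝ) (9 / 50), μ (2 * t) ∈ ymGibbsMeasures (d := 4) (fundamentalRep (Fin 2)) t := by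
    intro t _
    have h := hμ (2 * t)
    rwa [show (2 : ℝ) * (2 * t / 4) = t by ring] at h
  exact CouplingResponse.contDiffOn_one_of_hasDerivAt (fun t ht => su2_hasDerivAt_freeEnergyDensity hμsel ht)
    (su2_continuousOn_energyDensity hμsel)

/-- **C-LIP-STAR for one plaquette, tree coupling**: along any DLR selection on `[0, 9/50]` there is a constant
`A_p` with `|⟨Re tr U_p⟩_{μ β'} - ⟨Re tr U_p⟩_{μ β}| ≤ A_p |β' - β|` on `[0, 9/50]²` (g8's
`su2_abs_integral_sub_integral_le_star` at `β_W = 2β`, times the normalisation `Re tr = 2 W`). -/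
theorem su2_exists_plaquette_lipschitz
    {μ : ℝ → Measure (LGConfig 4 (Matrix.specialUnitaryGroup (Fin 2) ℂ))}
    (hμ : ∀ β ∈ Icc (0 : ℝ) (9 / 50), μ β ∈ ymGibbsMeasures (d := 4) (fundamentalRep (Fin 2)) β) :
    ∃ A : ZdPlaquette 4 → ℝ, ∀ p : ZdPlaquette 4, ∀ β ∈ Icc (0 : ℝ) (9 / 50), ∀ β' ∈ Icc (0 : ℝ) (9 / 50),
      |(∫ U, plaquetteObs (fundamentalRep (Fin 2)) p.1 p.2.1.1 p.2.1.2 U ∂(μ β')) -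
          ∫ U, plaquetteObs (fundamentalRep (Fin 2)) p.1 p.2.1.1 p.2.1.2 U ∂(μ β)| ≤ A p * |β' - β| := by
  -- membership in the `β_W`-normalised form `𝒢(2 (2β / 4))`
  have hm : ∀ β ∈ Icc (0 : ℝ) (9 / 50),
      μ β ∈ ymGibbsMeasures (d := 4) (fundamentalRep (Fin 2)) (2 * (2 * β / 4)) := fun β hβ => by
    rw [show (2 : ℝ) * (2 * β / 4) = β by ring]; exact hμ β hβ
  have key : ∀ p : ZdPlaquette 4, ∃ K : ℝ, ∀ β ∈ Icc (0 : ℝ) (9 / 50), ∀ β' ∈ Icc (0 : ℝ) (9 / 50),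
      |(∫ U, zdPlaquetteObs (fundamentalRep (Fin 2)) p.1 p.2.1.1 p.2.1.2 U ∂(μ β')) -
          ∫ U, zdPlaquetteObs (fundamentalRep (Fin 2)) p.1 p.2.1.1 p.2.1.2 U ∂(μ β)| ≤ K * |2 * β' - 2 * β| :=
    fun p => ⟨_, fun β hβ β' hβ' =>
      CouplingResponse.su2_abs_integral_sub_integral_le_star (le_refl (9 / 25 : ℝ))
        (βW := 2 * β') (βW' := 2 * β) (by linarith [hβ'.1]) (by linarith [hβ'.2]) (by linarith [hβ.1])
        (by linarith [hβ.2]) (hm β' hβ') (hm β hβ)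
        (isLipschitzCylinder_zdPlaquetteObs (N := 2) p.1 p.2.2) (x₀ := p.1) (D := 1)
        (fun e he => by simpa using norm_fst_sub_le_of_mem_plaquetteEdges he)⟩
  choose K hK using key
  refine ⟨fun p => 4 * K p, fun p β hβ β' hβ' => ?_⟩
  have hscale : ∀ t : ℝ, ∫ U, plaquetteObs (fundamentalRep (Fin 2)) p.1 p.2.1.1 p.2.1.2 U ∂(μ t) =
      2 * ∫ U, zdPlaquetteObs (fundamentalRep (Fin 2)) p.1 p.2.1.1 p.2.1.2 U ∂(μ t) := fun t => by
    rw [← integral_const_mul]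
    refine integral_congr_ae (ae_of_all _ fun U => ?_)
    rw [CouplingResponse.plaquetteObs_fundamentalRep_eq_mul_zdPlaquetteObs]
    norm_num
  have h := hK p β hβ β' hβ'
  rw [show (2 : ℝ) * β' - 2 * β = 2 * (β' - β) by ring, abs_mul, abs_two] at h
  rw [hscale β', hscale β, ← mul_sub, abs_mul, abs_two]
  nlinarith [h, abs_nonneg (β' - β)]

/-- ★ **`f ∈ C^{1,1}[0, 9/50]` with a `β`-uniform constant**: there is `C` with
`|f(β') - f(β) - (β' - β) f'(β)| ≤ C (β' - β)²` for all `β, β' ∈ [0, 9/50]` — the exact Taylor squeeze fed with the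
C-LIP-STAR Lipschitz bound of g8 (`su2_abs_integral_sub_integral_le_star`). -/
theorem su2_freeEnergyDensity_taylor_le
    {μ : ℝ → Measure (LGConfig 4 (Matrix.specialUnitaryGroup (Fin 2) ℂ))}
    (hμ : ∀ β ∈ Icc (0 : ℝ) (9 / 50), μ β ∈ ymGibbsMeasures (d := 4) (fundamentalRep (Fin 2)) β) :
    ∃ C : ℝ, ∀ β ∈ Icc (0 : ℝ) (9 / 50), ∀ β' ∈ Icc (0 : ℝ) (9 / 50),
      |freeEnergyDensity 4 (fundamentalRep (Fin 2)) β' - freeEnergyDensity 4 (fundamentalRep (Fin 2)) β -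
          (-∑ q : 𝔓₄, ((2 : ℝ) - ∫ U, plaquetteObs (fundamentalRep (Fin 2)) 0 q.1.1 q.1.2 U ∂(μ β))) * (β' - β)| ≤
        C * (β' - β) ^ 2 := by
  haveI := secondCountable_su2
  obtain ⟨A, hA⟩ := su2_exists_plaquette_lipschitz hμ
  refine ⟨∑ q : 𝔓₄, A ((0 : Literature.Probability.LatticeModels.Site 4), q), fun β hβ β' hβ' => ?_⟩
  have ht := abs_freeEnergyDensity_taylor_le (d := 4) (fundamentalRep (Fin 2)) (continuous_fundamentalRep _)
    (hμ β hβ) (su2_isZdTranslationInvariant hβ (hμ β hβ)) (hμ β' hβ') (su2_isZdTranslationInvariant hβ' (hμ β' hβ'))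
  push_cast at ht
  refine ht.trans ?_
  have hdiff : (-∑ q : 𝔓₄, ((2 : ℝ) - ∫ U, plaquetteObs (fundamentalRep (Fin 2)) 0 q.1.1 q.1.2 U ∂(μ β'))) -
      (-∑ q : 𝔓₄, ((2 : ℝ) - ∫ U, plaquetteObs (fundamentalRep (Fin 2)) 0 q.1.1 q.1.2 U ∂(μ β))) =
      ∑ q : 𝔓₄, ((∫ U, plaquetteObs (fundamentalRep (Fin 2)) 0 q.1.1 q.1.2 U ∂(μ β')) -
        ∫ U, plaquetteObs (fundamentalRep (Fin 2)) 0 q.1.1 q.1.2 U ∂(μ β)) := by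
    rw [neg_sub_neg, ← Finset.sum_sub_distrib]
    exact Finset.sum_congr rfl fun q _ => by ring
  rw [hdiff]
  have hsum : |∑ q : 𝔓₄, ((∫ U, plaquetteObs (fundamentalRep (Fin 2)) 0 q.1.1 q.1.2 U ∂(μ β')) -
        ∫ U, plaquetteObs (fundamentalRep (Fin 2)) 0 q.1.1 q.1.2 U ∂(μ β))| ≤
      (∑ q : 𝔓₄, A ((0 : Literature.Probability.LatticeModels.Site 4), q)) * |β' - β| := by
    rw [Finset.sum_mul]
    exact (Finset.abs_sum_le_sum_abs _ _).trans (Finset.sum_le_sum fun q _ =>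
      hA ((0 : Literature.Probability.LatticeModels.Site 4), q) β hβ β' hβ')
  calc _ ≤ (∑ q : 𝔓₄, A ((0 : Literature.Probability.LatticeModels.Site 4), q)) * |β' - β| * |β' - β| :=
        mul_le_mul_of_nonneg_right hsum (abs_nonneg _)
    _ = (∑ q : 𝔓₄, A ((0 : Literature.Probability.LatticeModels.Site 4), q)) * (β' - β) ^ 2 := by
        rw [mul_assoc, abs_mul_abs_self]; ring

end SU2

end Summit.Ventures.YMGap.PressureRegularity

end
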